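import Literature.AlgebraicGeometry.Frobenioids.ArithmeticFrobenioidDivisorTransportSquare
import HarnessLib

/-!
# Frobenioids I, Thm. 6.4 (iii) for an arbitrary `Ψ′` — piece (G2) in the BASE letter: everything read at the
# bases `Base(u₁A)`, `Base(u₂Ψ′A)` of the comparison-functor images, `γ = Base(σ_A) ≫ η^rlf_{u₁A}`

Mochizuki, *The geometry of Frobenioids I: the general theory*, Kyushu J. Math. **62** (2008) 293–400,
Thm. 6.4 (iii) p. 114, proof p. 115 l. 44 – p. 116 l. 4; Cor. 4.11 (iv) p. 92; Prop. 5.3 p. 103.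
[cite: MochizukiFrdI2008, Thm. 6.4 (iii) p.114] [cite: MochizukiFrdI2008, Cor. 4.11 (iv) p.92]

PROOF-ONLY sequel of `ArithmeticFrobenioidDivisorTransportSquare` (cell abc-iut, seat abc-iut-L1-d2; row
«T64iii-ARBITRARY-Ψ′» piece (G2), L1-lead R129 (1)).  The assembler abc-iut-L1-t3 types the perfected transport `θ`
and the prime/degree readings over the bases OF THE `u_i`-IMAGES, `X₁ = Base(u₁A)`, `X₂ = Base(u₂Ψ′A)` (STATUS
10:03:23Z `hG2`), whereas the comparison functors `u_i : (C_i^pf)^un-tr → C_i^rlf` lie over `D_i` only up to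
`β_i : u_i ⋙ Base ≅ Base` (e.g. through `PreFrobenioid.untrComparison`, which is over `D` up to isomorphism).  This
file gives (G2) in that BASE letter, for an arbitrary `θ : Φ₁^pf(X₁) → Φ₂^pf(X₂)` satisfying the `β`-conjugated
Div-clause `θ(β₁^* Div φ) = β₂^* Div(Ψ′ φ)` — with the SIMPLER base isomorphism `γ = Base(σ_A) ≫ η^rlf_{u₁A} :
X₂ ≅ ΨBase(X₁)` (no `β` left):

* `PreFrobenioidData.transport_square_compat_baseLetter` — `ι₂(θ(β₁^* Div φ)) = γ^* E^rlf_{X₁}(ι₁(β₁^* Div φ))`;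
* `PreFrobenioidData.exists_baseIso_transport_compat_baseLetter` — `∃ γ : X₂ ≅ ΨBase(X₁)`, `γ.hom = Base(σ_A) ≫ η^rlf`,
  `∀ x ∈ Φ₁^pf(X₁)`, `ι₂(θ x) = γ^* E^rlf_{X₁}(ι₁ x)` (given that every `m ∈ Φ₁^pf(Base A)` is a `Div` out of `A`);
* `PreFrobenioidData.exists_baseIso_transport_compat_baseLetter_of_divClause` — the same for the `β`-conjugate
  `x ↦ β₂^* θ((β₁⁻¹)^* x)` of a `θ` in the plain letter `θ(Div φ) = Div(Ψ′φ)` (abc-iut-L1-d1's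
  `exists_perfectedDivisorTransport_pfUntr_at_arith`).
Inputs: Div-clauses of `u₁`, `u₂`, `Ψ^rlf`, naturality of `ι₁`, `ι₂` in pull-backs, the square `σ`, sharp `Φ₂^rlf`.
Nothing here is specific to the abc programme; no side taken on [IUTchIII] Cor. 3.12.
-/

namespace Literature.AlgebraicGeometry.Frobenioids

namespace PreFrobenioidData

open CategoryTheory

section Square

variable {U₁ : Type*} [Category U₁] {U₂ : Type*} [Category U₂] {R₁ : Type*} [Category R₁] {R₂ : Type*} [Category R₂]
  {D₁ : Type*} [Category D₁] {D₂ : Type*} [Category D₂]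
  (SU₁ : PreFrobenioidData U₁ D₁) (SU₂ : PreFrobenioidData U₂ D₂)
  (SR₁ : PreFrobenioidData R₁ D₁) (SR₂ : PreFrobenioidData R₂ D₂)
  -- `ι_i : Φ_i^pf → Φ_i^rlf`, natural in pull-backs
  (ι₁ : ∀ X : D₁, SU₁.Mon X →* SR₁.Mon X) (ι₂ : ∀ X : D₂, SU₂.Mon X →* SR₂.Mon X)
  (hι₁ : ∀ ⦃X Y : D₁⦄ (f : Y ⟶ X) (m : SU₁.Mon X), ι₁ Y (SU₁.pull f m) = SR₁.pull f (ι₁ X m))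
  (hι₂ : ∀ ⦃X Y : D₂⦄ (f : Y ⟶ X) (m : SU₂.Mon X), ι₂ Y (SU₂.pull f m) = SR₂.pull f (ι₂ X m))
  -- the comparison functors `u_i`, over `D_i` up to `β_i`, with their Div-clauses
  (u₁ : U₁ ⥤ R₁) (β₁ : u₁ ⋙ SR₁.base ≅ SU₁.base)
  (hu₁ : ∀ ⦃A B : U₁⦄ (φ : A ⟶ B), SR₁.div (u₁.map φ) = SR₁.pull (β₁.hom.app A) (ι₁ _ (SU₁.div φ)))
  (u₂ : U₂ ⥤ R₂) (β₂ : u₂ ⋙ SR₂.base ≅ SU₂.base)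
  (hu₂ : ∀ ⦃A B : U₂⦄ (φ : A ⟶ B), SR₂.div (u₂.map φ) = SR₂.pull (β₂.hom.app A) (ι₂ _ (SU₂.div φ)))
  (Ψ' : U₁ ⥤ U₂)
  -- `Ψ^rlf` with its Cor. 4.11 data and Div-clause
  (Ψr : R₁ ⥤ R₂) (ΨB : D₁ ⥤ D₂) (Er : DivisorMonoidIsoOverBase SR₁ SR₂ ΨB) (ηr : Ψr ⋙ SR₂.base ≅ SR₁.base ⋙ ΨB)
  (hΨr : ∀ ⦃P Q : R₁⦄ (ψ : P ⟶ Q), SR₂.div (Ψr.map ψ) = SR₂.pull (ηr.hom.app P) (Er.iso _ (SR₁.div ψ)))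
  (σ : Ψ' ⋙ u₂ ≅ u₁ ⋙ Ψr) (hsharp : ∀ Y : D₂, IsSharp (SR₂.Mon Y))

include hι₁ hι₂ hu₁ hu₂ hΨr hsharp

/-- **(G2), base letter.**  For `φ : A → B` and any `θ : Φ₁^pf(Base(u₁A)) → Φ₂^pf(Base(u₂Ψ′A))` with
`θ(β₁^* Div φ) = β₂^* Div(Ψ′φ)`: `ι₂(θ(β₁^* Div φ)) = (Base(σ_A) ≫ η^rlf_{u₁A})^* E^rlf_{Base(u₁A)}(ι₁(β₁^* Div φ))`.
[cite: MochizukiFrdI2008, Thm. 6.4 (iii) p.114] -/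
theorem transport_square_compat_baseLetter {A B : U₁} (φ : A ⟶ B)
    (θ : SU₁.Mon (SR₁.base.obj (u₁.obj A)) → SU₂.Mon (SR₂.base.obj (u₂.obj (Ψ'.obj A))))
    (hθ : θ (SU₁.pull (β₁.hom.app A) (SU₁.div φ)) = SU₂.pull (β₂.hom.app (Ψ'.obj A)) (SU₂.div (Ψ'.map φ))) :
    ι₂ _ (θ (SU₁.pull (β₁.hom.app A) (SU₁.div φ))) =
      SR₂.pull (SR₂.base.map (σ.hom.app A) ≫ ηr.hom.app (u₁.obj A))
        (Er.iso (SR₁.base.obj (u₁.obj A)) (ι₁ _ (SU₁.pull (β₁.hom.app A) (SU₁.div φ)))) := by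
  -- the components of `σ` are isomorphisms: `Div = 0`, `deg_Fr = 1`
  have hσA : SR₂.div (σ.hom.app A) = 1 := SR₂.div_hom_eq_one_of_iso (hsharp _) (σ.app A)
  have hσB : SR₂.div (σ.hom.app B) = 1 := SR₂.div_hom_eq_one_of_iso (hsharp _) (σ.app B)
  have hdB : SR₂.degFr (σ.hom.app B) = 1 := SR₂.degFr_hom_eq_one_of_iso (σ.app B)
  -- `Div` of the naturality square of `σ` at `φ`
  have hdiv := congrArg SR₂.div (σ.hom.naturality φ)
  rw [SR₂.div_comp, SR₂.div_comp, hσB, hσA, hdB, map_one, one_mul, PNat.one_coe, pow_one, one_pow,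
    mul_one] at hdiv
  have hdiv' : SR₂.div (u₂.map (Ψ'.map φ)) = SR₂.pull (SR₂.base.map (σ.hom.app A)) (SR₂.div (Ψr.map (u₁.map φ))) :=
    hdiv
  -- left: `ι₂(θ(β₁^* Div φ)) = ι₂(β₂^* Div(Ψ′φ)) = β₂^* ι₂(Div Ψ′φ) = Div(u₂Ψ′φ)`
  have hL : ι₂ _ (θ (SU₁.pull (β₁.hom.app A) (SU₁.div φ))) = SR₂.div (u₂.map (Ψ'.map φ)) :=
    ((congrArg (fun x => ι₂ _ x) hθ).trans (hι₂ (β₂.hom.app (Ψ'.obj A)) _)).trans (hu₂ (Ψ'.map φ)).symm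
  -- right: `Div(Ψ^rlf u₁ φ) = η^* E(Div u₁φ) = η^* E(β₁^* ι₁ Div φ) = η^* E(ι₁ (β₁^* Div φ))`
  have hR : SR₂.div (Ψr.map (u₁.map φ)) =
      SR₂.pull (ηr.hom.app (u₁.obj A)) (Er.iso (SR₁.base.obj (u₁.obj A)) (ι₁ _ (SU₁.pull (β₁.hom.app A) (SU₁.div φ)))) := by
    refine (hΨr (u₁.map φ)).trans ?_
    refine congrArg (fun x => SR₂.pull (ηr.hom.app (u₁.obj A)) (Er.iso _ x)) ?_
    exact (hu₁ φ).trans (hι₁ (β₁.hom.app A) _).symm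
  refine hL.trans (hdiv'.trans ?_)
  refine (congrArg (fun x => SR₂.pull (SR₂.base.map (σ.hom.app A)) x) hR).trans ?_
  exact (SR₂.pull_comp _ _ _).symm

/-- **(G2), base letter, packaged** (abc-iut-L1-t3's `hG2`): for `A` and any `θ : Φ₁^pf(X₁) → Φ₂^pf(X₂)`,
`X₁ = Base(u₁A)`, `X₂ = Base(u₂Ψ′A)`, with `θ(β₁^* Div φ) = β₂^* Div(Ψ′φ)` on arrows out of `A`, if every
`m ∈ Φ₁^pf(Base A)` is such a `Div`, then `∃ γ : X₂ ≅ ΨBase(X₁)`, `γ.hom = Base(σ_A) ≫ η^rlf_{u₁A}`, with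
`ι₂(θ x) = γ^* E^rlf_{X₁}(ι₁ x)` for all `x ∈ Φ₁^pf(X₁)`. [cite: MochizukiFrdI2008, Thm. 6.4 (iii) p.114] -/
theorem exists_baseIso_transport_compat_baseLetter (A : U₁)
    (θ : SU₁.Mon (SR₁.base.obj (u₁.obj A)) → SU₂.Mon (SR₂.base.obj (u₂.obj (Ψ'.obj A))))
    (hθ : ∀ ⦃B : U₁⦄ (φ : A ⟶ B),
      θ (SU₁.pull (β₁.hom.app A) (SU₁.div φ)) = SU₂.pull (β₂.hom.app (Ψ'.obj A)) (SU₂.div (Ψ'.map φ)))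
    (hgen : ∀ m : SU₁.Mon (SU₁.base.obj A), ∃ (B : U₁) (φ : A ⟶ B), SU₁.div φ = m) :
    ∃ γ : SR₂.base.obj (u₂.obj (Ψ'.obj A)) ≅ ΨB.obj (SR₁.base.obj (u₁.obj A)),
      γ.hom = SR₂.base.map (σ.hom.app A) ≫ ηr.hom.app (u₁.obj A) ∧
      ∀ x : SU₁.Mon (SR₁.base.obj (u₁.obj A)),
        ι₂ _ (θ x) = SR₂.pull γ.hom (Er.iso (SR₁.base.obj (u₁.obj A)) (ι₁ _ x)) := by
  refine ⟨SR₂.base.mapIso (σ.app A) ≪≫ ηr.app (u₁.obj A), rfl, fun x => ?_⟩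
  -- `x = β₁^* m` for `m := (β₁⁻¹)^* x`, and `m = Div φ`
  obtain ⟨B, φ, hφ⟩ := hgen (SU₁.pull (β₁.inv.app A) x)
  have hx : SU₁.pull (β₁.hom.app A) (SU₁.div φ) = x :=
    ((congrArg (fun m => SU₁.pull (β₁.hom.app A) m) hφ).trans (SU₁.pull_comp _ _ _).symm).trans
      (((congrArg (fun f => SU₁.pull f x) (β₁.hom_inv_id_app A))).trans (SU₁.pull_id _ _))
  rw [← hx]
  exact transport_square_compat_baseLetter SU₁ SU₂ SR₁ SR₂ ι₁ ι₂ hι₁ hι₂ u₁ β₁ hu₁ u₂ β₂ hu₂ Ψ' Ψr ΨB Er ηr hΨr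
    σ hsharp φ θ (hθ φ)

/-- **(G2), base letter, from a `θ` in the plain letter** `θ(Div φ) = Div(Ψ′φ)` (abc-iut-L1-d1's perfected
transport at `A`): its `β`-conjugate `x ↦ β₂^* θ((β₁⁻¹)^* x)` satisfies the base letter, so
`∃ γ : X₂ ≅ ΨBase(X₁)`, `γ.hom = Base(σ_A) ≫ η^rlf_{u₁A}`, with `ι₂(β₂^* θ((β₁⁻¹)^* x)) = γ^* E^rlf_{X₁}(ι₁ x)` for
all `x ∈ Φ₁^pf(X₁)`. [cite: MochizukiFrdI2008, Thm. 6.4 (iii) p.114] -/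
theorem exists_baseIso_transport_compat_baseLetter_of_divClause (A : U₁)
    (θ : SU₁.Mon (SU₁.base.obj A) → SU₂.Mon (SU₂.base.obj (Ψ'.obj A)))
    (hθ : ∀ ⦃B : U₁⦄ (φ : A ⟶ B), θ (SU₁.div φ) = SU₂.div (Ψ'.map φ))
    (hgen : ∀ m : SU₁.Mon (SU₁.base.obj A), ∃ (B : U₁) (φ : A ⟶ B), SU₁.div φ = m) :
    ∃ γ : SR₂.base.obj (u₂.obj (Ψ'.obj A)) ≅ ΨB.obj (SR₁.base.obj (u₁.obj A)),
      γ.hom = SR₂.base.map (σ.hom.app A) ≫ ηr.hom.app (u₁.obj A) ∧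
      ∀ x : SU₁.Mon (SR₁.base.obj (u₁.obj A)),
        ι₂ _ (SU₂.pull (β₂.hom.app (Ψ'.obj A)) (θ (SU₁.pull (β₁.inv.app A) x))) =
          SR₂.pull γ.hom (Er.iso (SR₁.base.obj (u₁.obj A)) (ι₁ _ x)) := by
  refine exists_baseIso_transport_compat_baseLetter SU₁ SU₂ SR₁ SR₂ ι₁ ι₂ hι₁ hι₂ u₁ β₁ hu₁ u₂ β₂ hu₂ Ψ' Ψr ΨB Er
    ηr hΨr σ hsharp A (fun x => SU₂.pull (β₂.hom.app (Ψ'.obj A)) (θ (SU₁.pull (β₁.inv.app A) x))) ?_ hgen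
  intro B φ
  -- `(β₁⁻¹)^* β₁^* Div φ = Div φ`
  have h : SU₁.pull (β₁.inv.app A) (SU₁.pull (β₁.hom.app A) (SU₁.div φ)) = SU₁.div φ :=
    ((SU₁.pull_comp _ _ _).symm.trans (congrArg (fun f => SU₁.pull f (SU₁.div φ)) (β₁.inv_hom_id_app A))).trans
      (SU₁.pull_id _ _)
  exact congrArg (fun x => SU₂.pull (β₂.hom.app (Ψ'.obj A)) x) ((congrArg θ h).trans (hθ φ))

end Square

end PreFrobenioidData

end Literature.AlgebraicGeometry.Frobenioids
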